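import Literature.Computability.MetaComplexity.ListDecodableCodePolyLists
import Literature.Computability.Complexity.IrreducibilityLLLKernel
import HarnessLib

/-!
# A polynomial-time list-decodable binary code (Hirahara 2018, Thm. 4.7), IV: the decoder with advice and its correctness

Topic `Literature/Computability/MetaComplexity`, fourth file of the vendoring of the code of
S. Hirahara, *Non-black-box worst-case to average-case reductions within NP*, FOCS 2018 / ECCC
TR18-138, **Thm. 4.7** (`ListDecodableCode.lean`: the concatenated Reed–Solomon/Hadamard code
`LDC.enc`, Parseval, averaging; `ListDecodableCodeSudan.lean`: Sudan's interpolation and identity,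
multiplicity, Newton lifting, over a field; `ListDecodableCodePolyLists.lean`: the same on
coefficient lists). Here the whole DECODER is written as a functional program on lists and proved
correct in the advice form consumed by `GapMINKTCodeAdvice.lean`
(`Hirahara2018_gapMINKT_mem_PromiseP_of_adviceCode`):

* `LDC.blockAgreeL`, `LDC.candL b e r α` — the inner (Hadamard) lists: all `v < 2^b` whose
  codeword agrees with block `α` of `r` on `≥ (2^b + ⌊2^b/e⌋)/2` positions (`length_candL_le`:
  at most `4e²` of them, by `card_hadamard_agree_mul_sq_le`);
* `LDC.ptsL` — the interpolation points `(α mod q, v)`, `v ∈ candL α`; `LDC.rowL` — the row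
  `(βⁱ vʲ)_{j<J, i<I}` of Sudan's linear system; `LDC.JOf e = 16e³`, `LDC.IOf = #pts/J + 1`;
* `LDC.decodeCoreL` (from a kernel vector and the advice `(μ, β*, v*)`: `∂_Y^{μ-1}`, shift by `β*`,
  Newton from `v* = p_x(β*)`, shift back, read the bits) and **`LDC.decodeL e n r μ β v`** (the
  kernel vector by `LLLFactoring.kerVecMod`, column elimination modulo `q`);
* **`LDC.exists_advice_decodeL`** — *if `|x| = n`, `e ≥ 1`, `|r| = 2^{ℓ(n,e)}` and `r` agrees with
  `Enc(1ᵉ, x)` on at least `(1/2 + 1/e)·2^ℓ` positions, then for some `μ < 16e³` and `β, v < q`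
  the decoder outputs exactly `x`: `decodeL e n r μ β v = x`.*

The proof follows [Sud97, §2] / Arora–Barak §19.3–19.4 with the parameters: `B = 2^b`,
`q ∈ (B/2, B]` prime, `q > 2^{11} e⁴ (n+1)`; good blocks (agreement `≥ 1/2 + 1/(2e)`) number
`≥ B/(e-1)` (averaging), hence `≥ B/(2(e-1))` distinct residues `β = α mod q` carry the true symbol
`p_x(β)` in their list; `#pts ≤ 4e²B`, so `I - 1 ≤ B/(4e)` and the `(1, n-1)`-weighted degree
`(I-1) + (J-1)(n-1)` of the interpolating `Q ≠ 0` (more unknowns `I·J` than points) is below the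
number of roots: `Q(X, p_x(X)) = 0`; `deg_Y Q < J < q` gives the multiplicity step, the non-root
`β*` of `(∂_Y^μ Q)(X, p_x)` exists since its degree is `< q`, and Newton's iteration from
`(β*, p_x(β*))` returns `p_x(X + β*)`, whose shift back is `p_x`. No named fact is introduced.

## References

* S. Hirahara, ECCC TR18-138 (2018) / FOCS 2018, Thm. 4.7, Cor. 4.8 [Hirahara2018].
* M. Sudan, *Decoding of Reed Solomon codes beyond the error-correction bound*, J. Complexity 13
  (1997) 180–193, §2 (Lemmas 3–5).
* S. Arora, B. Barak, *Computational Complexity: A Modern Approach*, CUP 2009, §19.3–19.4 and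
  Thm. 19.24 [AroraBarakCC2009].
* D. E. Knuth, *The Art of Computer Programming*, Vol. 2, 3rd ed., 1998, §4.6.2, Algorithm N
  (null space by column elimination) [KnuthTAOCP2].
-/

noncomputable section

namespace Literature.Computability.MetaComplexity

open Polynomial Finset Literature.Computability.Complexity Literature.Computability.Complexity.LLLFactoring
  Literature.Computability.Complexity.SumcheckMA Literature.LinearAlgebra.Matrix.ListGauss
open scoped Polynomial.Bivariate

namespace LDC

/-! ### List/finset bookkeeping -/

/-- The length of a filtered `List.range` is the cardinality of the filtered `Finset.range`. [folklore] -/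
theorem length_filter_range (p : ℕ → Bool) : ∀ n : ℕ, ((List.range n).filter p).length = ((range n).filter fun i => p i).card
  | 0 => by simp
  | n + 1 => by
    rw [List.range_succ, List.filter_append, List.length_append, length_filter_range p n, range_add_one, filter_insert]
    by_cases hp : p n
    · rw [if_pos hp, card_insert_of_notMem (by simp)]; simp [hp]
    · rw [if_neg hp]; simp [hp]

/-- `Σ_{k < I·J} f k = Σ_{j<J} Σ_{i<I} f (j·I + i)`. [folklore] -/
theorem sum_range_mul {M : Type*} [AddCommMonoid M] (f : ℕ → M) (I : ℕ) : ∀ J : ℕ,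
    ∑ k ∈ range (I * J), f k = ∑ j ∈ range J, ∑ i ∈ range I, f (j * I + i)
  | 0 => by simp
  | J + 1 => by rw [Nat.mul_succ, sum_range_add, sum_range_mul f I J, sum_range_succ]; simp [mul_comm]

/-- The integer dot product of lists of equal length as a sum over indices. [folklore] -/
theorem idot_eq_sum : ∀ (u w : List ℤ), u.length = w.length → idot u w = ∑ k ∈ range u.length, u.getD k 0 * w.getD k 0
  | [], _, _ => by simp [idot]
  | a :: u, [], h => by simp at h
  | a :: u, b :: w, h => by
    have ih := idot_eq_sum u w (by simpa using h)
    rw [idot] at ih ⊢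
    rw [List.zipWith_cons_cons, List.sum_cons, ih, List.length_cons, sum_range_succ']
    simp [add_comm]

/-! ### Parameters of the outer decoder -/

/-- The `Y`-degree bound `J = 16 e³` of the interpolating polynomial. [cite: AroraBarakCC2009, §19 (Sudan's algorithm, choice of degrees)] -/
def JOf (e : ℕ) : ℕ := 16 * e ^ 3

/-- The `X`-degree bound `I = #points / J + 1` (so that `I·J > #points`). [cite: AroraBarakCC2009, §19] -/
def IOf (npts J : ℕ) : ℕ := npts / J + 1

/-- The Hadamard excess `D = ⌊2^b / e⌋`: inner lists collect agreement `≥ (2^b + D)/2`. [cite: AroraBarakCC2009, §19.4] -/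
def DOf (b e : ℕ) : ℕ := 2 ^ b / e

/-- `I · J > #points`. [folklore] -/
theorem lt_IOf_mul {npts J : ℕ} (hJ : 0 < J) : npts < IOf npts J * J := by
  have h1 : npts / J * J + npts % J = npts := Nat.div_add_mod' npts J
  have h2 := Nat.mod_lt npts hJ
  rw [IOf, Nat.add_mul, one_mul]
  omega

/-! ### The inner lists -/

/-- The agreement of block `α` of `r` with the Hadamard codeword of `v`, as a list count. [cite: AroraBarakCC2009, §19.4] -/
def blockAgreeL (b : ℕ) (r : List Bool) (α v : ℕ) : ℕ :=
  ((List.range (2 ^ b)).filter fun y => r.getD (α * 2 ^ b + y) false == hadN b v y).length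

/-- `blockAgreeL = blockAgree`. [folklore] -/
theorem blockAgreeL_eq (b : ℕ) (r : List Bool) (α v : ℕ) : blockAgreeL b r α v = blockAgree b r α v := by
  rw [blockAgreeL, blockAgree, length_filter_range]
  congr 1
  exact filter_congr fun y _ => by simp

/-- **The inner (Hadamard) list of block `α`**: all `v < 2^b` with `2^b + D ≤ 2 · blockAgree`.
[cite: AroraBarakCC2009, §19.4 (decoding the inner code of a concatenated code by brute force)] -/
def candL (b e : ℕ) (r : List Bool) (α : ℕ) : List ℕ :=
  (List.range (2 ^ b)).filter fun v => Nat.ble (2 ^ b + DOf b e) (2 * blockAgreeL b r α v)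

/-- Membership in the inner list. [folklore] -/
theorem mem_candL_iff {b e : ℕ} {r : List Bool} {α v : ℕ} :
    v ∈ candL b e r α ↔ v < 2 ^ b ∧ 2 ^ b + DOf b e ≤ 2 * blockAgree b r α v := by
  rw [candL, List.mem_filter, List.mem_range, Nat.ble_eq, blockAgreeL_eq]

/-- `2eD ≥ 2^b` as soon as `2e ≤ 2^b` (`e ≥ 1`). [folklore] -/
theorem two_pow_le_two_mul_DOf {b e : ℕ} (he : 1 ≤ e) (hb : 2 * e ≤ 2 ^ b) : 2 ^ b ≤ 2 * e * DOf b e := by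
  rw [DOf]
  have h1 := Nat.div_add_mod (2 ^ b) e
  have h2 := Nat.mod_lt (2 ^ b) (by omega : 0 < e)
  have : e * (2 ^ b / e) + e > 2 ^ b := by omega
  nlinarith

/-- **The inner lists are short**: `|candL α| ≤ 4e²` (Parseval, `card_hadamard_agree_mul_sq_le`). [cite: AroraBarakCC2009, §19.3–19.4] -/
theorem length_candL_le {b e : ℕ} (he : 1 ≤ e) (hb : 2 * e ≤ 2 ^ b) (r : List Bool) (α : ℕ) :
    (candL b e r α).length ≤ 4 * e ^ 2 := by
  have hP := card_hadamard_agree_mul_sq_le b (fun y => r.getD (α * 2 ^ b + y) false) (DOf b e)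
  have hlen : (candL b e r α).length = ((range (2 ^ b)).filter fun v => 2 ^ b + DOf b e ≤
      2 * ((range (2 ^ b)).filter fun y => r.getD (α * 2 ^ b + y) false = hadN b v y).card).card := by
    rw [candL, length_filter_range]
    congr 1
    refine filter_congr fun v _ => ?_
    rw [Nat.ble_eq, blockAgreeL_eq, blockAgree]
  rw [hlen]
  set c := ((range (2 ^ b)).filter fun v => 2 ^ b + DOf b e ≤
      2 * ((range (2 ^ b)).filter fun y => r.getD (α * 2 ^ b + y) false = hadN b v y).card).card
  have hD := two_pow_le_two_mul_DOf he hb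
  have hDpos : 0 < DOf b e := by
    rw [DOf]; exact Nat.div_pos (by omega) (by omega)
  -- `c · D² ≤ 4^b = (2^b)² ≤ (2eD)²`
  have h4 : (4 : ℕ) ^ b = (2 ^ b) ^ 2 := by rw [← pow_mul, mul_comm, pow_mul]; norm_num
  have h1 : c * DOf b e ^ 2 ≤ (2 * e * DOf b e) ^ 2 := by
    rw [h4] at hP; exact hP.trans (Nat.pow_le_pow_left hD 2)
  have h2 : c * DOf b e ^ 2 ≤ 4 * e ^ 2 * DOf b e ^ 2 := by
    calc c * DOf b e ^ 2 ≤ (2 * e * DOf b e) ^ 2 := h1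
      _ = 4 * e ^ 2 * DOf b e ^ 2 := by ring
  exact Nat.le_of_mul_le_mul_right h2 (by positivity)

/-! ### The interpolation points and Sudan's linear system -/

/-- **The interpolation points**: `(α mod q, v)` for `α < 2^b`, `v ∈ candL α`.
[cite: AroraBarakCC2009, §19 (Sudan's algorithm, input: the pairs `(aᵢ, bᵢ)`)] -/
def ptsL (b e q : ℕ) (r : List Bool) : List (ℕ × ℕ) :=
  ((List.range (2 ^ b)).map fun α => (candL b e r α).map fun v => (α % q, v)).flatten

/-- Membership in the point list. [folklore] -/
theorem mem_ptsL_iff {b e q : ℕ} {r : List Bool} {pt : ℕ × ℕ} :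
    pt ∈ ptsL b e q r ↔ ∃ α < 2 ^ b, pt.1 = α % q ∧ pt.2 ∈ candL b e r α := by
  obtain ⟨β', v⟩ := pt
  rw [ptsL, List.mem_flatten]
  constructor
  · rintro ⟨l, hl, hpt⟩
    obtain ⟨α, hα, rfl⟩ := List.mem_map.1 hl
    obtain ⟨v, hv, hv'⟩ := List.mem_map.1 hpt
    simp only [Prod.mk.injEq] at hv'
    obtain ⟨rfl, rfl⟩ := hv'
    exact ⟨α, List.mem_range.1 hα, rfl, hv⟩
  · rintro ⟨α, hα, h1, h2⟩
    subst h1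
    exact ⟨_, List.mem_map.2 ⟨α, List.mem_range.2 hα, rfl⟩, List.mem_map.2 ⟨v, h2, rfl⟩⟩

/-- **The point list is short**: `#pts ≤ 2^b · 4e²`. [folklore] -/
theorem length_ptsL_le {b e : ℕ} (he : 1 ≤ e) (hb : 2 * e ≤ 2 ^ b) (q : ℕ) (r : List Bool) :
    (ptsL b e q r).length ≤ 2 ^ b * (4 * e ^ 2) := by
  rw [ptsL, List.length_flatten, List.map_map]
  have h : ∀ x ∈ (List.range (2 ^ b)).map (List.length ∘ fun α => (candL b e r α).map fun v => (α % q, v)), x ≤ 4 * e ^ 2 := by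
    intro x hx
    obtain ⟨α, -, rfl⟩ := List.mem_map.1 hx
    simpa using length_candL_le he hb r α
  exact (List.sum_le_card_nsmul _ _ h).trans (by simp)

/-- **Row of Sudan's linear system** at the point `(β, v)`: entry `k = j·I + i` is `βⁱ vʲ mod q`.
[cite: AroraBarakCC2009, §19 (the constraints `Q(aᵢ, bᵢ) = Σ Q_{ij} aᵢ^i bᵢ^j = 0`)] -/
def rowL (q I J : ℕ) (pt : ℕ × ℕ) : List ℤ :=
  (List.range (I * J)).map fun k => (((pt.1 ^ (k % I) % q) * (pt.2 ^ (k / I) % q) % q : ℕ) : ℤ)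

/-- Rows have length `I · J`. [folklore] -/
@[simp] theorem length_rowL (q I J : ℕ) (pt : ℕ × ℕ) : (rowL q I J pt).length = I * J := by simp [rowL]

/-- Entries of a row. [folklore] -/
theorem getD_rowL {q I J : ℕ} (pt : ℕ × ℕ) {k : ℕ} (hk : k < I * J) :
    (rowL q I J pt).getD k 0 = (((pt.1 ^ (k % I) % q) * (pt.2 ^ (k / I) % q) % q : ℕ) : ℤ) := by
  rw [rowL, List.getD_eq_getElem _ _ (by simpa using hk), List.getElem_map, List.getElem_range]

/-- Rows are reduced (`q ≥ 1`). [folklore] -/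
theorem reduced_rowL {q : ℕ} (hq : 0 < q) (I J : ℕ) (pt : ℕ × ℕ) : Reduced q (rowL q I J pt) := by
  intro c hc
  obtain ⟨k, -, rfl⟩ := List.mem_map.1 hc
  exact ⟨by positivity, by exact_mod_cast Nat.mod_lt _ hq⟩

/-- **Pairing a row with a coefficient vector evaluates the interpolating polynomial at the point.**
[cite: AroraBarakCC2009, §19] -/
theorem cast_idot_rowL {q I J : ℕ} (pt : ℕ × ℕ) {w : List ℤ} (hw : w.length = I * J) :
    ((idot (rowL q I J pt) w : ℤ) : ZMod q) =
      (bivOfCoeffs I J (fun i j => ((w.getD (j * I + i) 0 : ℤ) : ZMod q))).evalEval (pt.1 : ZMod q) (pt.2 : ZMod q) := by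
  rw [idot_eq_sum _ _ (by rw [length_rowL, hw]), length_rowL, evalEval_bivOfCoeffs, Int.cast_sum, sum_range_mul]
  refine sum_congr rfl fun j hj => sum_congr rfl fun i hi => ?_
  have hiI : i < I := List.mem_range.1 (by simpa using hi)
  have hI : 0 < I := by omega
  have hk : j * I + i < I * J := by
    have := List.mem_range.1 (by simpa using hj); nlinarith
  rw [getD_rowL pt hk, Nat.mul_add_mod_of_lt hiI, show (j * I + i) / I = j by
    rw [Nat.add_comm, Nat.add_mul_div_right _ _ hI, Nat.div_eq_of_lt hiI, Nat.zero_add]]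
  push_cast
  ring


/-! ### The decoder -/

/-- **The core of the decoder**, from a kernel vector `w` of Sudan's system and the advice
`(μ, β, v)`: take `∂_Y^{μ-1}` of the interpolating polynomial, shift `X ↦ X + β`, run `n` steps of
Newton's iteration from the constant coefficient `v` with the Fermat inverse of
`δ = (∂_Y R)(0, v)`, shift back by `-β ≡ q - β`, and read the `n` message bits.
[cite: Hirahara2018, Thm. 4.7 (the list decoder, advice form)] -/
def decodeCoreL (q n I J : ℕ) (w : List ℤ) (μ β v : ℕ) : List Bool :=
  readBitsL n (shiftL q ((q : ℤ) - β)
    (newtonRunL q n ((derivL q (μ - 1) (tabL I J w)).map (shiftL q β)) v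
      (invMod q (deltaL q ((derivL q (μ - 1) (tabL I J w)).map (shiftL q β)) v))))

/-- The rows of Sudan's linear system at all interpolation points. [cite: AroraBarakCC2009, §19] -/
def rowsL (b e q : ℕ) (r : List Bool) : List (List ℤ) :=
  (ptsL b e q r).map (rowL q (IOf (ptsL b e q r).length (JOf e)) (JOf e))

/-- **The decoder with explicit parameters `b, q`**: kernel vector of Sudan's system by column
elimination modulo `q` (`LLLFactoring.kerVecMod`), then `decodeCoreL`; the empty string if the
system has only the trivial solution (never, under the promise). [cite: Hirahara2018, Thm. 4.7] -/
def decodeWithL (b q e n : ℕ) (r : List Bool) (μ β v : ℕ) : List Bool :=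
  match kerVecMod q (IOf (ptsL b e q r).length (JOf e) * JOf e) (rowsL b e q r) with
  | none => []
  | some w => decodeCoreL q n (IOf (ptsL b e q r).length (JOf e)) (JOf e) w μ β v

/-- **The decoder `Dec_{n, 1/e}` of Thm. 4.7 in advice form**: on `(e, n, r)` and the advice
`(μ, β, v)`, with the parameters `b = bOf n e`, `q = qOf n e` of `ListDecodableCode.lean`.
[cite: Hirahara2018, Thm. 4.7] -/
def decodeL (e n : ℕ) (r : List Bool) (μ β v : ℕ) : List Bool := decodeWithL (bOf n e) (qOf n e) e n r μ β v

/-- Unfolding `decodeWithL` on a successful kernel computation. [folklore] -/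
theorem decodeWithL_of_eq_some {b q e n : ℕ} {r : List Bool} {μ β v : ℕ} {w : List ℤ}
    (h : kerVecMod q (IOf (ptsL b e q r).length (JOf e) * JOf e) (rowsL b e q r) = some w) :
    decodeWithL b q e n r μ β v = decodeCoreL q n (IOf (ptsL b e q r).length (JOf e)) (JOf e) w μ β v := by
  rw [decodeWithL, h]

/-! ### Correctness of the core: Newton's iteration from the advised simple point -/

/-- **The core recovers the message.** Over a prime field `𝔽_q`, let `Q` be the polynomial of the
table of `w`, `x` a message of length `n` with polynomial `p_x`, `μ ≥ 1` with
`(∂_Y^{μ-1} Q)(X, p_x) = 0`, and `β*` a point where `(∂_Y^{μ} Q)(X, p_x)` does not vanish. Then the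
core, advised with `(μ, β*, p_x(β*))`, outputs `x`. [cite: Hirahara2018, Thm. 4.7 (decoding)] -/
theorem decodeCoreL_eq {q : ℕ} [hq : Fact q.Prime] {n I J : ℕ} {w : List ℤ} {x : List Bool} (hx : x.length = n)
    {μ : ℕ} {βs : ZMod q} (hμ : 1 ≤ μ)
    (hev : (derivative^[μ - 1] (bivL q (tabL I J w))).eval (msgPoly q x) = 0)
    (hne : ((derivative^[μ] (bivL q (tabL I J w))).eval (msgPoly q x)).eval βs ≠ 0) :
    decodeCoreL q n I J w μ βs.val ((msgPoly q x).eval βs).val = x := by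
  have hq0 : 0 < q := hq.out.pos
  set Qt := derivative^[μ - 1] (bivL q (tabL I J w)) with hQt
  set px := msgPoly q x with hpx
  set Rl := (derivL q (μ - 1) (tabL I J w)).map (shiftL q (βs.val : ℤ)) with hRl
  set τ : (ZMod q)[X] →+* (ZMod q)[X] := (taylorAlgHom βs : (ZMod q)[X] →+* (ZMod q)[X]) with hτ
  have hβcast : (((βs.val : ℕ) : ℤ) : ZMod q) = βs := by rw [Int.cast_natCast, ZMod.natCast_zmod_val]
  have hRb : bivL q Rl = Qt.map τ := by
    rw [hRl, bivL_map_shiftL, bivL_derivL, hβcast]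
  set f := taylor βs px with hf
  -- `R(Z, f(Z)) = 0`
  have hR : (bivL q Rl).eval f = 0 := by
    rw [hRb, hf, hτ, eval_map_taylor, hev, map_zero]
  -- the advised constant coefficient
  set v := (px.eval βs).val with hv
  have hvcast : (((v : ℕ) : ℤ) : ZMod q) = f.coeff 0 := by
    rw [Int.cast_natCast, hv, ZMod.natCast_zmod_val, hf, taylor_coeff_zero]
  -- `δ ≠ 0`
  have hder : derivative Qt = derivative^[μ] (bivL q (tabL I J w)) := by
    rw [hQt]
    obtain ⟨k, rfl⟩ : ∃ k, μ = k + 1 := ⟨μ - 1, by omega⟩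
    rw [Nat.add_sub_cancel, Function.iterate_succ_apply']
  have hδ0 : (derivative (bivL q Rl)).evalEval 0 (f.coeff 0) ≠ 0 := by
    rw [hRb, derivative_map_taylor, evalEval_zero_map_taylor, hf, taylor_coeff_zero, ← eval_eval_eq_evalEval, hder]
    exact hne
  set δ := deltaL q Rl v with hδ
  have hδcast : ((δ : ℤ) : ZMod q) = (derivative (bivL q Rl)).evalEval 0 (f.coeff 0) := by
    rw [hδ, cast_deltaL, hvcast]
  have hδne : ((δ : ℤ) : ZMod q) ≠ 0 := by rw [hδcast]; exact hδ0
  set δinv := invMod q δ with hδinv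
  have hinv : (derivative (bivL q Rl)).evalEval 0 (f.coeff 0) * ((δinv : ℤ) : ZMod q) = 1 := by
    rw [← hδcast, hδinv, cast_invMod_eq_inv δ hδne, mul_inv_cancel₀ hδne]
  -- Newton's iteration returns `f`
  have hfdeg : f.degree < n := by
    rw [hf, degree_taylor, ← hx]; exact degree_msgPoly_lt x
  have hnewton : toZMod q (newtonRunL q n Rl v δinv) = f := by
    rw [toZMod_newtonRunL, hvcast, newtonPoly_eq hR hinv hfdeg]
  -- shifting back gives `p_x`
  have hback : toZMod q (shiftL q ((q : ℤ) - βs.val) (newtonRunL q n Rl v δinv)) = px := by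
    rw [toZMod_shiftL_eq_taylor, hnewton, hf]
    have : (((q : ℤ) - (βs.val : ℕ) : ℤ) : ZMod q) = -βs := by
      push_cast
      rw [ZMod.natCast_self, ZMod.natCast_zmod_val, zero_sub]
    rw [this, taylor_neg_taylor]
  -- read the bits
  have hread := readBitsL_eq hq.out.two_le (reduced_shiftL hq0 _ _) hback
  rw [hx] at hread
  exact hread

/-! ### Correctness of the decoder -/

/-- Agreements never exceed the length. [folklore] -/
theorem agreeCount_le_length (r f : List Bool) : NWStr.agreeCount r f ≤ r.length :=
  (card_filter_le _ _).trans (card_range _).le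

/-- The fibres of `α ↦ α mod q` on `[0, B)` have at most two elements when `B < 2q`. [folklore] -/
theorem card_filter_mod_eq_le_two {B q : ℕ} (hB : B < 2 * q) (s : Finset ℕ) (hs : s ⊆ range B) (a : ℕ) :
    (s.filter fun α => α % q = a).card ≤ 2 := by
  have hsub : (s.filter fun α => α % q = a) ⊆ {a, a + q} := by
    intro α hα
    rw [mem_filter] at hα
    have hαB : α < B := mem_range.1 (hs hα.1)
    have hdiv : α / q < 2 := Nat.div_lt_of_lt_mul (by linarith)
    have h := Nat.div_add_mod α q
    rw [hα.2] at h
    rw [mem_insert, mem_singleton]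
    interval_cases (α / q) <;> omega
  exact (card_le_card hsub).trans (card_insert_le _ _ |>.trans (by simp))

/-- **The parameter inequality of Sudan's identity**: with `B > 2^{11}·2 e⁴(n+1)`-sized field,
`#pts ≤ 4e²B` points, `J = 16e³` and `B ≤ 2(e-1)·T`, the weighted degree `(I-1) + (J-1)(n-1)` is
below the number `T` of good residues. [cite: AroraBarakCC2009, §19 (Thm. 19.24, the count)] -/
theorem sudan_param_lt {B e n P T : ℕ} (he : 2 ≤ e) (hbig : 2 ^ 11 * (e ^ 4 * (n + 1)) < B)
    (hP : P ≤ B * (4 * e ^ 2)) (hT : B ≤ 2 * (e - 1) * T) :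
    (IOf P (JOf e) - 1) + (JOf e - 1) * (n - 1) < T := by
  have he0 : 0 < e := by omega
  have hI : IOf P (JOf e) - 1 = P / JOf e := Nat.add_sub_cancel _ _
  -- `I - 1 ≤ B / (4e)`
  have h1 : P / JOf e ≤ B / (4 * e) := by
    calc P / JOf e ≤ B * (4 * e ^ 2) / JOf e := Nat.div_le_div_right hP
      _ = (4 * e ^ 2) * B / ((4 * e ^ 2) * (4 * e)) := by rw [JOf, mul_comm B]; ring_nf
      _ = B / (4 * e) := Nat.mul_div_mul_left _ _ (by positivity)
  have h2 : 4 * e * (B / (4 * e)) ≤ B := Nat.mul_div_le _ _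
  have h3 : 2 * (2 * (e - 1) * (IOf P (JOf e) - 1)) ≤ B := by
    rw [hI]
    calc 2 * (2 * (e - 1) * (P / JOf e)) ≤ 2 * (2 * e * (B / (4 * e))) :=
          Nat.mul_le_mul_left _ (Nat.mul_le_mul (by omega) h1)
      _ = 4 * e * (B / (4 * e)) := by ring
      _ ≤ B := h2
  have h4 : 2 * (2 * (e - 1) * ((JOf e - 1) * (n - 1))) ≤ 64 * e ^ 4 * n := by
    have ha : e - 1 ≤ e := Nat.sub_le _ _
    have hb : JOf e - 1 ≤ 16 * e ^ 3 := Nat.sub_le _ _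
    have hc : n - 1 ≤ n := Nat.sub_le _ _
    calc 2 * (2 * (e - 1) * ((JOf e - 1) * (n - 1))) ≤ 2 * (2 * e * ((16 * e ^ 3) * n)) :=
          Nat.mul_le_mul_left _ (Nat.mul_le_mul (Nat.mul_le_mul_left _ ha) (Nat.mul_le_mul hb hc))
      _ = 64 * e ^ 4 * n := by ring
  have h5 : 64 * e ^ 4 * n < B := by
    have : 64 * e ^ 4 * n ≤ 2 ^ 11 * (e ^ 4 * (n + 1)) := by nlinarith [Nat.zero_le (e ^ 4)]
    omega
  -- `2(e-1)·LHS < B ≤ 2(e-1)·T`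
  have h6 : 2 * (e - 1) * ((IOf P (JOf e) - 1) + (JOf e - 1) * (n - 1)) < 2 * (e - 1) * T := by
    have : 2 * (2 * (e - 1) * ((IOf P (JOf e) - 1) + (JOf e - 1) * (n - 1))) < 2 * B := by
      rw [Nat.mul_add, Nat.mul_add]; omega
    omega
  exact Nat.lt_of_mul_lt_mul_left h6


/-- **Correctness of the advised decoder (Hirahara 2018, Thm. 4.7, list decoding in advice form).**
If `|x| = n`, `e ≥ 1`, `|r| = 2^{ℓ(n,e)}` and `r` agrees with `Enc(1ᵉ, x)` on at least
`(1/2 + 1/e)·2^ℓ` positions (in the integer form `(e+2)·2^ℓ ≤ 2e·agree`), then for some advice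
`μ < 16e³`, `β < q`, `v < q` the decoder outputs `x`. [cite: Hirahara2018, Thm. 4.7]
[cite: AroraBarakCC2009, §19.3–19.4, Thm. 19.24] -/
theorem exists_advice_decodeL {n e : ℕ} {x r : List Bool} (hx : x.length = n) (he : 1 ≤ e)
    (hr : r.length = 2 ^ ell n e) (hagree : (e + 2) * 2 ^ ell n e ≤ 2 * e * NWStr.agreeCount r (enc e x)) :
    ∃ μ β v, μ < JOf e ∧ β < qOf n e ∧ v < qOf n e ∧ decodeL e n r μ β v = x := by
  subst hx
  set n := x.length with hn
  set b := bOf n e with hb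
  set q := qOf n e with hq
  set B := 2 ^ b with hB
  set J := JOf e with hJ
  haveI hprime : Fact q.Prime := ⟨qOf_prime n e⟩
  have hq0 : 0 < q := hprime.out.pos
  have hqB : q ≤ B := qOf_le_two_pow n e
  have hB2q : B < 2 * q := two_pow_lt_two_mul_qOf n e
  have hbigq : 2 ^ 11 * (e ^ 4 * (n + 1)) < q := lt_qOf n e
  have hbig : 2 ^ 11 * (e ^ 4 * (n + 1)) < B := hbigq.trans_le hqB
  have hJq : J < q := by
    have : 16 * e ^ 3 ≤ 2 ^ 11 * (e ^ 4 * (n + 1)) := by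
      have h4 : e ^ 3 ≤ e ^ 4 * (n + 1) := by
        calc e ^ 3 ≤ e ^ 4 := Nat.pow_le_pow_right he (by norm_num)
          _ ≤ e ^ 4 * (n + 1) := Nat.le_mul_of_pos_right _ (Nat.succ_pos n)
      omega
    rw [hJ, JOf]; omega
  have hJ0 : 0 < J := by rw [hJ, JOf]; positivity
  have h2eB : 2 * e ≤ B := by
    have : 2 * e ≤ 2 ^ 11 * (e ^ 4 * (n + 1)) := by
      have h4 : e ≤ e ^ 4 * (n + 1) := by
        calc e = e ^ 1 := (pow_one e).symm
          _ ≤ e ^ 4 := Nat.pow_le_pow_right he (by norm_num)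
          _ ≤ e ^ 4 * (n + 1) := Nat.le_mul_of_pos_right _ (Nat.succ_pos n)
      omega
    omega
  -- the codeword, blockwise
  have hℓ : 2 ^ ell n e = B * B := by rw [ell, two_mul, pow_add]
  have henc : enc e x = encWith b q x := rfl
  have hagree_le : NWStr.agreeCount r (enc e x) ≤ B * B := by rw [← hℓ, ← hr]; exact agreeCount_le_length _ _
  -- `e ≥ 2`
  have he2 : 2 ≤ e := by
    have hpos : 0 < B * B := by positivity
    have h1 : (e + 2) * (B * B) ≤ 2 * e * (B * B) := by
      rw [← hℓ]; exact hagree.trans (Nat.mul_le_mul_left _ (hℓ ▸ hagree_le))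
    have h2 := Nat.le_of_mul_le_mul_right h1 hpos
    omega
  have hsum := agreeCount_encWith b q x (g := r) (by rw [hr, hℓ])
  -- good blocks
  set A : ℕ → ℕ := fun α => blockAgree b r α (symb q x (α % q)) with hA
  set Good := (range B).filter fun α => (e + 1) * B ≤ 2 * e * A α with hGood
  have hgood : B ≤ (e - 1) * Good.card :=
    le_mul_card_goodBlocks (M := B) (N := B) A (fun α _ => blockAgree_le _ _ _ _) (by positivity)
      (by rw [← hsum, ← henc, ← hℓ]; exact hagree)
  -- good residues
  set Tset := Good.image fun α => α % q with hTset
  have hfib : ∀ a ∈ Tset, (Good.filter fun α => α % q = a).card ≤ 2 := fun a _ =>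
    card_filter_mod_eq_le_two hB2q Good (filter_subset _ _) a
  have hTcard : Good.card ≤ 2 * Tset.card := card_le_mul_card_image _ 2 hfib
  have hBT : B ≤ 2 * (e - 1) * Tset.card := by
    calc B ≤ (e - 1) * Good.card := hgood
      _ ≤ (e - 1) * (2 * Tset.card) := Nat.mul_le_mul_left _ hTcard
      _ = 2 * (e - 1) * Tset.card := by ring
  -- the true symbols of good blocks are listed
  have hmem : ∀ α ∈ Good, (α % q, symb q x (α % q)) ∈ ptsL b e q r := by
    intro α hα
    rw [hGood, mem_filter, mem_range] at hα
    refine mem_ptsL_iff.2 ⟨α, hα.1, rfl, mem_candL_iff.2 ⟨(symb_lt hq0 x _).trans_le hqB, ?_⟩⟩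
    -- `e (B + B/e) ≤ (e+1) B ≤ 2 e A`
    have h1 : e * (B + DOf b e) ≤ (e + 1) * B := by
      rw [DOf, Nat.mul_add, Nat.add_mul, one_mul]
      exact Nat.add_le_add_left (Nat.mul_div_le B e) _
    have h2 : e * (B + DOf b e) ≤ e * (2 * A α) := by
      calc e * (B + DOf b e) ≤ (e + 1) * B := h1
        _ ≤ 2 * e * A α := hα.2
        _ = e * (2 * A α) := by ring
    exact Nat.le_of_mul_le_mul_left h2 (by omega)
  -- Sudan's linear system has a nonzero solution
  set pts := ptsL b e q r with hpts
  set I := IOf pts.length J with hI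
  set rows := rowsL b e q r with hrows_def
  have hrows_eq : rows = pts.map (rowL q I J) := rfl
  have hrows : ∀ ρ ∈ rows, ρ.length = I * J := by
    intro ρ hρ
    obtain ⟨pt, -, rfl⟩ := List.mem_map.1 (hrows_eq ▸ hρ)
    exact length_rowL _ _ _ _
  have hI0 : 0 < I := Nat.succ_pos _
  obtain ⟨u, hu0, hu⟩ := exists_kernel_vec (K := ZMod q)
    (fun (p : Fin pts.length) (idx : Fin (I * J)) => (((rowL q I J (pts.get p)).getD idx 0 : ℤ) : ZMod q))
    (lt_IOf_mul (npts := pts.length) hJ0)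
  have hsome : (kerVecMod q (I * J) rows).isSome = true := by
    refine kerVecMod_complete hrows (List.ofFn u) (List.length_ofFn ..) ?_ ?_
    · obtain ⟨idx, hidx⟩ : ∃ idx, u idx ≠ 0 := by
        by_contra hall
        push Not at hall
        exact hu0 (funext hall)
      exact ⟨u idx, List.mem_ofFn.2 ⟨idx, rfl⟩, hidx⟩
    · intro ρ hρ
      obtain ⟨k, hk, rfl⟩ := List.getElem_of_mem (hrows_eq ▸ hρ)
      rw [List.length_map] at hk
      have hcast : castVec q (rowL q I J pts[k]) =
          List.ofFn (fun idx : Fin (I * J) => (((rowL q I J (pts.get ⟨k, hk⟩)).getD idx 0 : ℤ) : ZMod q)) := by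
        refine List.ext_getElem (by simp) fun i h1 h2 => ?_
        rw [List.length_ofFn] at h2
        have hlen : i < (rowL q I J pts[k]).length := by rw [length_rowL]; exact h2
        simp only [castVec, List.getElem_map, List.getElem_ofFn, List.get_eq_getElem]
        rw [List.getD_eq_getElem _ _ hlen]
      rw [List.getElem_map, hcast, dot_ofFn]
      exact hu ⟨k, hk⟩
  obtain ⟨w, hw⟩ := Option.isSome_iff_exists.1 hsome
  obtain ⟨hwlen, ⟨z, hz, hz0⟩, hworth⟩ := kerVecMod_sound hrows hw
  -- the interpolating polynomial
  set c : ℕ → ℕ → ZMod q := fun i j => ((w.getD (j * I + i) 0 : ℤ) : ZMod q) with hc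
  set Q := bivOfCoeffs I J c with hQdef
  have hQ : bivL q (tabL I J w) = Q := bivL_tabL I J w
  have hQ0 : Q ≠ 0 := by
    obtain ⟨k, hk, rfl⟩ := List.getElem_of_mem hz
    have hkIJ : k < I * J := by rw [← hwlen]; exact hk
    have hi : k % I < I := Nat.mod_lt _ hI0
    have hj : k / I < J := Nat.div_lt_of_lt_mul hkIJ
    refine bivOfCoeffs_ne_zero hi hj ?_
    rw [hc]
    simp only
    rw [Nat.div_add_mod' k I, List.getD_eq_getElem _ _ hk]
    exact hz0
  have hQroot : ∀ pt ∈ pts, Q.evalEval (pt.1 : ZMod q) (pt.2 : ZMod q) = 0 := fun pt hpt => by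
    rw [hQdef, hc, ← cast_idot_rowL pt hwlen]
    rw [hworth _ (hrows_eq ▸ List.mem_map.2 ⟨pt, hpt, rfl⟩)]
  -- Sudan's identity: `Q(X, p_x(X)) = 0`
  set px := msgPoly q x with hpx
  set S := Tset.image (Nat.cast : ℕ → ZMod q) with hS
  have hTsub : ∀ a ∈ Tset, a < q := by
    intro a ha
    obtain ⟨α, -, rfl⟩ := mem_image.1 ha
    exact Nat.mod_lt _ hq0
  have hScard : S.card = Tset.card := by
    refine card_image_of_injOn fun a ha a' ha' h => ?_
    have h1 := congrArg ZMod.val h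
    rwa [ZMod.val_cast_of_lt (hTsub a ha), ZMod.val_cast_of_lt (hTsub a' ha')] at h1
  have hroots : ∀ s ∈ S, Q.evalEval s (px.eval s) = 0 := by
    intro s hs
    obtain ⟨a, ha, rfl⟩ := mem_image.1 hs
    obtain ⟨α, hα, rfl⟩ := mem_image.1 ha
    rw [hpx, ← cast_symb]
    exact hQroot _ (hmem α hα)
  have hshape : HasShape I J Q := hasShape_bivOfCoeffs I J c
  have hpxdeg : px.natDegree ≤ n - 1 := natDegree_msgPoly_le x
  have hPle : pts.length ≤ B * (4 * e ^ 2) := length_ptsL_le he h2eB q r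
  have hkey : (I - 1) + (J - 1) * (n - 1) < Tset.card := sudan_param_lt he2 hbig hPle hBT
  have hev0 : Q.eval px = 0 :=
    eval_eq_zero_of_card_lt S hroots (by rw [hScard]; exact (natDegree_eval_le hshape hpxdeg).trans_lt hkey)
  -- multiplicity
  have hQdeg : Q.natDegree < J := (natDegree_lt_iff_degree_lt hQ0).2 (degree_bivOfCoeffs_lt I J c)
  have hchar : ((Q.natDegree.factorial : ℕ) : ZMod q) ≠ 0 := by
    rw [Ne, ZMod.natCast_eq_zero_iff, hprime.out.dvd_factorial]
    omega
  obtain ⟨μ, hμ1, hμdeg, hevμ, hneμ⟩ := exists_multiplicity hQ0 hev0 hchar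
  -- the good point `β*`
  have hTq : Tset.card ≤ q := by
    calc Tset.card ≤ (range q).card := card_le_card fun a ha => mem_range.2 (hTsub a ha)
      _ = q := card_range q
  have hhdeg : ((derivative^[μ] Q).eval px).natDegree < Fintype.card (ZMod q) := by
    rw [ZMod.card]
    exact ((natDegree_eval_le (hshape.iterate_derivative μ) hpxdeg).trans_lt hkey).trans_le hTq
  obtain ⟨βs, hβs⟩ := exists_eval_ne_zero hneμ hhdeg
  -- conclusion
  refine ⟨μ, βs.val, (px.eval βs).val, lt_of_le_of_lt hμdeg hQdeg, ZMod.val_lt _, ZMod.val_lt _, ?_⟩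
  rw [decodeL, ← hb, ← hq, decodeWithL_of_eq_some hw]
  exact decodeCoreL_eq rfl hμ1 (by rw [hQ]; exact hevμ) (by rw [hQ]; exact hβs)

end LDC

end Literature.Computability.MetaComplexity

end
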